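import Mathlib
import Literature.Analysis.FluidPDE.Tao2016AveragedNS.RestartedCascadeFlows
import Literature.Analysis.FluidPDE.Tao2016AveragedNS.WeightedLatticeFlows
import Summits.NavierStokesRegularity.NavierStokesRegularity.Theorems.TaoLadderRungThreeGappedFrontRobustGaussianWeights
import HarnessLib

/-!
# `HeteroclinicTriggerChain` — crux `TriggerChainFrontStep` (item stmt-NavierStokesRegularity-22785):
  the CHAIN CERTIFICATE FORMAT — weights and the structural half of `GapData₂`

Blueprint item 3 (certificate design), structural half. The open stub `stub_chain_gap_of_normal_form` of
line `gapdata_v2` asks for format-v2 gap data `GapData₂ σ 1 j₀ (α₀+βσ) X₀ Z w r ρ θ₀ θ c₀ c env₀` plus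
the thin-tail clause. Everything in that conjunction EXCEPT the two dynamical clauses — (exist₀) exact
flows on the clock window from the ball, and the exact step with slack `StepSlack` — is bookkeeping about
the weight `w`, the reference set `Z` and the exact envelope `env₀`. This file fixes the intended weight
family and discharges that bookkeeping once and for all:

* the PIECEWISE WEIGHT `w k = 1` for `k < 0` (behind the front) and `w k = C · 2^{k²/2 + b k}` for
  `k ≥ 0` (Gaussian ahead), `C ≥ 1`, `b ≥ 1/2`: `w ≥ 1` (`htcCF_one_le_weight`), the tail growth (T1)
  `2(1+ε₀)^k w k ≤ w (k+1)` for `k ≥ 0` (`htcCF_weight_T1`), the thin tail `TailThin ε₀ w r`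
  (`htcCF_weight_tailThin`) and its UNIFORM form from `k = 0` on with the explicit constant
  `ϑ₀ = (r/C)·2^{(7/2−b)²/2 + 11/2 + b}` (`htcCF_weight_thin_uniform`), behind-tameness of the weights
  `w k ≤ C (1+ε₀)^{-k}` for `k ≤ 0` (`htcCF_weight_tame`);
* the inputs of the exact-flow theory `Literature.….WeightedLatticeFlows`
  (`exists_exact_pseudoFlowOn_of_apriori_bound`): admissible ratios `WeightRatiosLE ε₀ w A`
  (`htcCF_weightRatiosLE`) and the decay constant `(1 + (1+ε₀)^{10k})/w k ≤ 2 + 2^{51}/C`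
  (`htcCF_weight_decay_const`);
* `TameBehind` and `TailCompat` from the structural clauses on `Z` and `env₀`
  (`htcCF_tameBehind`, `htcCF_tailCompat`);
* the PACKAGING `htcCF_gapData₂`: `GapData₂ ∧ TailThin` from the sign/margin data, the structural
  clauses, and the two dynamical clauses taken as hypotheses — so the open stub reduces to exactly two
  statements about EXACT flows of the pinned table (see the crux note `Cruxes/TriggerChainFrontStep/
  DESIGN-NOTE-p5.md` for why `b ≍ log₂(1/β)` and for the lifespan pinch those two statements must meet).

HONEST FRAMING: elementary real-number inequalities and definitional packaging in the vocabulary of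
Tao 2016 §4/§6 (`RestartedCascadeFlows`, MODEL lattice); helper for the crux (no stub credit); nothing
here is a statement about the Navier–Stokes equations; no summit, rung or crux is proved by this file.
-/

noncomputable section

set_option linter.dupNamespace false

open Real Set

namespace Summit.NavierStokesRegularity.NavierStokesRegularity.Theorems

open Literature.Analysis.FluidPDE Literature.Analysis.FluidPDE.TaoCascade

/-! ### The piecewise weight: `1` behind the front, Gaussian ahead -/

/-- The piecewise weight is at least `1` everywhere (`C ≥ 1`, `b ≥ 0`). [folklore] -/
theorem htcCF_one_le_weight {C b : ℝ} (hC : 1 ≤ C) (hb : 0 ≤ b) (w : ℤ → ℝ)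
    (hwA : ∀ k : ℤ, 0 ≤ k → w k = C * (2 : ℝ) ^ ((k : ℝ) ^ 2 / 2 + b * k))
    (hwB : ∀ k : ℤ, k < 0 → w k = 1) : ∀ k, 1 ≤ w k := by
  intro k
  rcases lt_or_ge k 0 with hk | hk
  · rw [hwB k hk]
  · rw [hwA k hk]
    have hk' : (0 : ℝ) ≤ k := by exact_mod_cast hk
    have h1 : (1 : ℝ) ≤ (2 : ℝ) ^ ((k : ℝ) ^ 2 / 2 + b * k) :=
      Real.one_le_rpow (by norm_num) (by positivity)
    nlinarith

/-- **(T1) ahead of the front** for the piecewise weight: `2(1+ε₀)^k w k ≤ w (k+1)` for `k ≥ 0`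
(`0 ≤ ε₀ ≤ 1`, `C > 0`, `b ≥ 1/2`; from `GappedFrontRobust.gaussian_weight_T1`). [folklore] -/
theorem htcCF_weight_T1 {ε₀ C b : ℝ} (hε : 0 ≤ ε₀) (hε1 : ε₀ ≤ 1) (hC : 0 < C) (hb : 1 / 2 ≤ b)
    (w : ℤ → ℝ) (hwA : ∀ k : ℤ, 0 ≤ k → w k = C * (2 : ℝ) ^ ((k : ℝ) ^ 2 / 2 + b * k))
    (k : ℤ) (hk : 0 ≤ k) : 2 * (1 + ε₀) ^ (k : ℝ) * w k ≤ w (k + 1) := by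
  have h := GappedFrontRobust.gaussian_weight_T1 hε hε1 hC hb
    (fun k => C * (2 : ℝ) ^ ((k : ℝ) ^ 2 / 2 + b * k)) (fun _ => rfl) k hk
  rw [hwA k hk, hwA (k + 1) (by omega)]
  exact h

/-- **Thin tail** for the piecewise weight: `TailThin ε₀ w r` (`0 ≤ ε₀ ≤ 1`, `r ≥ 0`, `C > 0`, any
`b`; from `GappedFrontRobust.gaussian_weight_tailThin`, thresholds moved past `0`). [folklore] -/
theorem htcCF_weight_tailThin {ε₀ r C b : ℝ} (hε : 0 ≤ ε₀) (hε1 : ε₀ ≤ 1) (hr : 0 ≤ r) (hC : 0 < C)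
    (w : ℤ → ℝ) (hwA : ∀ k : ℤ, 0 ≤ k → w k = C * (2 : ℝ) ^ ((k : ℝ) ^ 2 / 2 + b * k)) :
    TailThin ε₀ w r := by
  intro ϑ hϑ
  obtain ⟨k₂, hk₂⟩ := GappedFrontRobust.gaussian_weight_tailThin hε hε1 hr hC
    (fun k => C * (2 : ℝ) ^ ((k : ℝ) ^ 2 / 2 + b * k)) (fun _ => rfl) ϑ hϑ
  refine ⟨max k₂ 0, fun k hk => ?_⟩
  have hk0 : 0 ≤ k := le_trans (le_max_right _ _) hk
  rw [hwA k hk0, hwA (k + 1) (by omega)]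
  exact hk₂ k (le_trans (le_max_left _ _) hk)

/-- **Uniform hand-over bound from the front on**: for the piecewise weight and `k ≥ 0`,
`(1+ε₀)^{5(k+2)/2} · r · w(k+1) ≤ ϑ₀ · (w k)²` with the explicit constant
`ϑ₀ = (r/C) · 2^{(7/2−b)²/2 + 11/2 + b}` (the quotient is `(r/C)·2^{−k²/2 + (7/2−b)k + 11/2 + b}` after
`(1+ε₀) ≤ 2`, and `−k²/2 + (7/2−b)k ≤ (7/2−b)²/2`). [folklore] -/
theorem htcCF_weight_thin_uniform {ε₀ r C b : ℝ} (hε : 0 ≤ ε₀) (hε1 : ε₀ ≤ 1) (hr : 0 ≤ r) (hC : 0 < C)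
    (w : ℤ → ℝ) (hwA : ∀ k : ℤ, 0 ≤ k → w k = C * (2 : ℝ) ^ ((k : ℝ) ^ 2 / 2 + b * k))
    (k : ℤ) (hk : 0 ≤ k) :
    (1 + ε₀) ^ ((5 : ℝ) * (k + 2) / 2) * r * w (k + 1) ≤
      r / C * (2 : ℝ) ^ ((7 / 2 - b) ^ 2 / 2 + 11 / 2 + b) * w k ^ 2 := by
  have h2 : (0 : ℝ) < 2 := by norm_num
  have hk' : (0 : ℝ) ≤ k := by exact_mod_cast hk
  rw [hwA k hk, hwA (k + 1) (by omega)]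
  push_cast
  -- (1+ε₀)^{5(k+2)/2} ≤ 2^{5(k+2)/2}
  have hgain : (1 + ε₀) ^ ((5 : ℝ) * (k + 2) / 2) ≤ (2 : ℝ) ^ ((5 : ℝ) * (k + 2) / 2) :=
    Real.rpow_le_rpow (by linarith) (by linarith) (by positivity)
  -- exponent bookkeeping
  set E1 : ℝ := ((k : ℝ) + 1) ^ 2 / 2 + b * ((k : ℝ) + 1) with hE1
  set E0 : ℝ := (k : ℝ) ^ 2 / 2 + b * k with hE0
  set G : ℝ := (5 : ℝ) * (k + 2) / 2 with hG
  set M : ℝ := (7 / 2 - b) ^ 2 / 2 + 11 / 2 + b with hM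
  have hexp : G + E1 ≤ M + (E0 + E0) := by
    rw [hG, hE1, hM, hE0]
    nlinarith [sq_nonneg ((k : ℝ) - (7 / 2 - b))]
  have hpow : (2 : ℝ) ^ G * (2 : ℝ) ^ E1 ≤ (2 : ℝ) ^ M * ((2 : ℝ) ^ E0 * (2 : ℝ) ^ E0) := by
    rw [← Real.rpow_add h2, ← Real.rpow_add h2, ← Real.rpow_add h2]
    exact Real.rpow_le_rpow_of_exponent_le (by norm_num) hexp
  have hposE1 : 0 < (2 : ℝ) ^ E1 := Real.rpow_pos_of_pos h2 _
  calc (1 + ε₀) ^ G * r * (C * (2 : ℝ) ^ E1)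
      ≤ (2 : ℝ) ^ G * r * (C * (2 : ℝ) ^ E1) := by
        have : 0 ≤ r * (C * (2 : ℝ) ^ E1) := by positivity
        nlinarith [hgain]
    _ = r * C * ((2 : ℝ) ^ G * (2 : ℝ) ^ E1) := by ring
    _ ≤ r * C * ((2 : ℝ) ^ M * ((2 : ℝ) ^ E0 * (2 : ℝ) ^ E0)) :=
        mul_le_mul_of_nonneg_left hpow (by positivity)
    _ = r / C * (2 : ℝ) ^ M * (C * (2 : ℝ) ^ E0) ^ 2 := by
        field_simp

/-- **Behind-tameness of the weights**: `w k ≤ C (1+ε₀)^{-k}` for `k ≤ 0` (`ε₀ ≥ 0`, `C ≥ 1`).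
[folklore] -/
theorem htcCF_weight_tame {ε₀ C b : ℝ} (hε : 0 ≤ ε₀) (hC : 1 ≤ C) (w : ℤ → ℝ)
    (hwA : ∀ k : ℤ, 0 ≤ k → w k = C * (2 : ℝ) ^ ((k : ℝ) ^ 2 / 2 + b * k))
    (hwB : ∀ k : ℤ, k < 0 → w k = 1) (k : ℤ) (hk : k ≤ 0) :
    w k ≤ C * (1 + ε₀) ^ (-(k : ℝ)) := by
  have hk' : (k : ℝ) ≤ 0 := by exact_mod_cast hk
  have hpow : 1 ≤ (1 + ε₀) ^ (-(k : ℝ)) := Real.one_le_rpow (by linarith) (by linarith)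
  rcases lt_or_eq_of_le hk with hlt | heq
  · rw [hwB k hlt]
    nlinarith
  · rw [heq, hwA 0 le_rfl]
    simp only [Int.cast_zero]
    norm_num

/-- **Admissible weight ratios** (input of the weighted exact-flow theory): the piecewise weight satisfies
`WeightRatiosLE ε₀ w ((1+ε₀)^{9/2} + (1+ε₀)² + C + ϑ₀/r)` with the `ϑ₀` of
`htcCF_weight_thin_uniform` (`0 ≤ ε₀ ≤ 1`, `r > 0`, `C ≥ 1`, `b ≥ 1/2`).
[cite: Tao2016AveragedNS, §4 (4.8) (the gains); cell vocabulary] -/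
theorem htcCF_weightRatiosLE {ε₀ r C b : ℝ} (hε : 0 ≤ ε₀) (hε1 : ε₀ ≤ 1) (hr : 0 < r) (hC : 1 ≤ C)
    (hb : 1 / 2 ≤ b) (w : ℤ → ℝ)
    (hwA : ∀ k : ℤ, 0 ≤ k → w k = C * (2 : ℝ) ^ ((k : ℝ) ^ 2 / 2 + b * k))
    (hwB : ∀ k : ℤ, k < 0 → w k = 1) :
    WeightRatiosLE ε₀ w ((1 + ε₀) ^ ((9 : ℝ) / 2) + (1 + ε₀) ^ (2 : ℝ) + C +
      (r / C * (2 : ℝ) ^ ((7 / 2 - b) ^ 2 / 2 + 11 / 2 + b)) / r) :=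
  weightRatiosLE_of_certificate_weights hε hr
    (htcCF_one_le_weight hC (by linarith) w hwA hwB)
    (htcCF_weight_T1 hε hε1 (by linarith) hb w hwA)
    (htcCF_weight_thin_uniform hε hε1 hr.le (by linarith) w hwA)
    (htcCF_weight_tame hε hC w hwA hwB)

/-- **Decay constant** (input of the weighted exact-flow theory, the a priori decay (4.5) inherited from
the weighted bound): `(1 + (1+ε₀)^{10k})/w k ≤ 2 + 2^{51}/C` for every `k` (behind: `≤ 2`; ahead:
`≤ (2/C)·2^{10k − k²/2} ≤ 2^{51}/C`). [folklore] -/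
theorem htcCF_weight_decay_const {ε₀ C b : ℝ} (hε : 0 ≤ ε₀) (hε1 : ε₀ ≤ 1) (hC : 1 ≤ C) (hb : 0 ≤ b)
    (w : ℤ → ℝ) (hwA : ∀ k : ℤ, 0 ≤ k → w k = C * (2 : ℝ) ^ ((k : ℝ) ^ 2 / 2 + b * k))
    (hwB : ∀ k : ℤ, k < 0 → w k = 1) (k : ℤ) :
    (1 + (1 + ε₀) ^ ((10 : ℝ) * k)) / w k ≤ 2 + (2 : ℝ) ^ (51 : ℝ) / C := by
  have h2 : (0 : ℝ) < 2 := by norm_num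
  have hC0 : 0 < C := by linarith
  have hbig : 0 ≤ (2 : ℝ) ^ (51 : ℝ) / C := div_nonneg (Real.rpow_nonneg h2.le _) hC0.le
  rcases lt_or_ge k 0 with hk | hk
  · -- behind: (1+ε₀)^{10k} ≤ 1
    rw [hwB k hk, div_one]
    have hk' : (k : ℝ) ≤ 0 := by exact_mod_cast hk.le
    have : (1 + ε₀) ^ ((10 : ℝ) * k) ≤ 1 :=
      Real.rpow_le_one_of_one_le_of_nonpos (by linarith) (by nlinarith)
    linarith
  · rw [hwA k hk]
    have hk' : (0 : ℝ) ≤ k := by exact_mod_cast hk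
    set E0 : ℝ := (k : ℝ) ^ 2 / 2 + b * k with hE0
    have hE0pos : 0 < (2 : ℝ) ^ E0 := Real.rpow_pos_of_pos h2 _
    -- numerator ≤ 2 · 2^{10k}
    have hnum : 1 + (1 + ε₀) ^ ((10 : ℝ) * k) ≤ 2 * (2 : ℝ) ^ ((10 : ℝ) * k) := by
      have h1 : (1 + ε₀) ^ ((10 : ℝ) * k) ≤ (2 : ℝ) ^ ((10 : ℝ) * k) :=
        Real.rpow_le_rpow (by linarith) (by linarith) (by positivity)
      have h1' : (1 : ℝ) ≤ (2 : ℝ) ^ ((10 : ℝ) * k) := Real.one_le_rpow (by norm_num) (by positivity)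
      linarith
    -- 2^{10k} ≤ 2^{50} · 2^{E0}
    have hexp : (10 : ℝ) * k ≤ 50 + E0 := by
      rw [hE0]; nlinarith [sq_nonneg ((k : ℝ) - 10)]
    have hpow : (2 : ℝ) ^ ((10 : ℝ) * k) ≤ (2 : ℝ) ^ (50 : ℝ) * (2 : ℝ) ^ E0 := by
      rw [← Real.rpow_add h2]; exact Real.rpow_le_rpow_of_exponent_le (by norm_num) hexp
    have h51 : (2 : ℝ) ^ (51 : ℝ) = 2 * (2 : ℝ) ^ (50 : ℝ) := by
      rw [show (51 : ℝ) = 1 + 50 by norm_num, Real.rpow_add h2, Real.rpow_one]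
    rw [div_le_iff₀ (by positivity)]
    calc 1 + (1 + ε₀) ^ ((10 : ℝ) * k) ≤ 2 * ((2 : ℝ) ^ (50 : ℝ) * (2 : ℝ) ^ E0) := by linarith
      _ = (2 : ℝ) ^ (51 : ℝ) / C * (C * (2 : ℝ) ^ E0) := by rw [h51]; field_simp
      _ ≤ (2 + (2 : ℝ) ^ (51 : ℝ) / C) * (C * (2 : ℝ) ^ E0) := by
          have : 0 ≤ C * (2 : ℝ) ^ E0 := by positivity
          nlinarith

/-! ### The structural clauses of the reference set and the envelope -/

/-- **`TameBehind`** from the structural clause (Z3) "reference amplitudes bounded ahead and growing at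
most like `(1+ε₀)^{|k|}` behind" and the behind-tameness of the piecewise weight.
[cite: Tao2016AveragedNS, §6.2 Prop. 6.3 (viii)–(ix) (statement shape); cell vocabulary, certificate format v2] -/
theorem htcCF_tameBehind {ε₀ C b C_Z : ℝ} {m : ℕ} (hε : 0 ≤ ε₀) (hC : 1 ≤ C) (w : ℤ → ℝ)
    (hwA : ∀ k : ℤ, 0 ≤ k → w k = C * (2 : ℝ) ^ ((k : ℝ) ^ 2 / 2 + b * k))
    (hwB : ∀ k : ℤ, k < 0 → w k = 1) (Z : Set (Fin m → ℤ → ℝ))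
    (hZ3 : ∀ z ∈ Z, ∀ (i : Fin m) (k : ℤ), |z i k| ≤ C_Z * (1 + (1 + ε₀) ^ (-(k : ℝ)))) :
    TameBehind ε₀ Z w := by
  refine ⟨max C_Z C, fun z hz i k => ?_, fun k hk => ?_⟩
  · have hpos : 0 ≤ 1 + (1 + ε₀) ^ (-(k : ℝ)) := by positivity
    exact (hZ3 z hz i k).trans (mul_le_mul_of_nonneg_right (le_max_left _ _) hpos)
  · have hpos : 0 ≤ (1 + ε₀) ^ (-(k : ℝ)) := by positivity
    exact (htcCF_weight_tame hε hC w hwA hwB k hk).trans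
      (mul_le_mul_of_nonneg_right (le_max_right _ _) hpos)

/-- **`TailCompat`** from the structural clauses (Z2) "reference states within a quarter tolerance of
zero beyond `k_Z`" and (E1) "the exact envelope at the shifted tolerance scale beyond `k_E`", together
with (T1) and the uniform hand-over bound of the piecewise weight (threshold `max 0 (max k_Z k_E)`,
`C₄ = ϑ₀`). [cite: Tao2016AveragedNS, §6.2 Prop. 6.3 (ix) (statement shape); cell vocabulary, certificate format v2] -/
theorem htcCF_tailCompat {ε₀ r C b K₀ : ℝ} {m : ℕ} {k_Z k_E : ℤ} (hε : 0 ≤ ε₀) (hε1 : ε₀ ≤ 1)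
    (hr : 0 ≤ r) (hC : 1 ≤ C) (hb : 1 / 2 ≤ b) (w : ℤ → ℝ)
    (hwA : ∀ k : ℤ, 0 ≤ k → w k = C * (2 : ℝ) ^ ((k : ℝ) ^ 2 / 2 + b * k))
    (Z : Set (Fin m → ℤ → ℝ)) (env₀ : ℤ → ℝ)
    (hZ2 : ∀ k : ℤ, k_Z ≤ k → ∀ z ∈ Z, ∀ i : Fin m, 4 * (w k * |z i k|) ≤ r)
    (hE1 : ∀ k : ℤ, k_E ≤ k → env₀ k ≤ K₀ * r ^ 2 / w (k - 1) ^ 2) :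
    TailCompat ε₀ Z w r env₀ := by
  refine ⟨max 0 (max k_Z k_E), K₀, r / C * (2 : ℝ) ^ ((7 / 2 - b) ^ 2 / 2 + 11 / 2 + b),
    fun k hk => ⟨?_, ?_, ?_, ?_⟩⟩
  · exact htcCF_weight_T1 hε hε1 (by linarith) hb w hwA k (le_trans (le_max_left _ _) hk)
  · exact hZ2 k (le_trans ((le_max_left _ _).trans (le_max_right _ _)) hk)
  · exact hE1 k (le_trans ((le_max_right _ _).trans (le_max_right _ _)) hk)
  · exact htcCF_weight_thin_uniform hε hε1 hr (by linarith) w hwA k (le_trans (le_max_left _ _) hk)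

/-! ### Packaging: `GapData₂ ∧ TailThin` from the two dynamical clauses -/

/-- **THE CHAIN CERTIFICATE FORMAT.** For the piecewise weight (`1` behind, `C·2^{k²/2+bk}` ahead,
`C ≥ 1`, `b ≥ 1/2`), scale ratio `0 ≤ ε₀ ≤ 1`, sign/margin data `0 < r`, `0 ≤ ρ < 1`,
`0 ≤ θ₀ < θ ≤ 1/2`, `0 < c₀ < c`, `0 < σ`, a reference set `Z` containing the rescaled datum with the
structural clauses (Z2) (quarter tolerance beyond `k_Z`) and (Z3) (tame amplitudes), an exact envelope
`env₀` with (E1) (tolerance scale beyond `k_E`), and the two DYNAMICAL clauses — (exist₀) defect-free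
flows on `[0,c]` from every ball state, and the exact step with slack `StepSlack σ ε₀ i₀ α Z w r ρ θ₀ c₀
env₀` — the data is format-v2 gap data with a thin tail: `GapData₂ σ ε₀ i₀ α X₀ Z w r ρ θ₀ θ c₀ c env₀ ∧
TailThin ε₀ w r` (the hypothesis shape of K_B₂ `GappedFrontRobustV2`, hence of the registered stub
`stub_gapped_front_robust_v2`). [cite: Tao2016AveragedNS, §6.3–6.4 Props. 6.4–6.5 (statement shape); cell vocabulary, certificate format v2] -/
theorem htcCF_gapData₂ {ε₀ σ r ρ θ₀ θ c₀ c C b C_Z K₀ : ℝ} {m : ℕ} {k_Z k_E : ℤ} {i₀ : Fin m}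
    {α : Fin m → Fin m → Fin m → ℤ × ℤ × ℤ → ℝ} {X₀ : Fin m → ℝ} {Z : Set (Fin m → ℤ → ℝ)}
    {w env₀ : ℤ → ℝ}
    (hε : 0 ≤ ε₀) (hε1 : ε₀ ≤ 1) (hr : 0 < r) (hρ : 0 ≤ ρ) (hρ1 : ρ < 1) (hθ₀ : 0 ≤ θ₀)
    (hθ : θ₀ < θ) (hθ1 : θ ≤ 1 / 2) (hc₀ : 0 < c₀) (hc : c₀ < c) (hσ : 0 < σ)
    (hC : 1 ≤ C) (hb : 1 / 2 ≤ b)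
    (hwA : ∀ k : ℤ, 0 ≤ k → w k = C * (2 : ℝ) ^ ((k : ℝ) ^ 2 / 2 + b * k))
    (hwB : ∀ k : ℤ, k < 0 → w k = 1)
    (hZ1 : datumState i₀ X₀ ∈ Z)
    (hZ2 : ∀ k : ℤ, k_Z ≤ k → ∀ z ∈ Z, ∀ i : Fin m, 4 * (w k * |z i k|) ≤ r)
    (hZ3 : ∀ z ∈ Z, ∀ (i : Fin m) (k : ℤ), |z i k| ≤ C_Z * (1 + (1 + ε₀) ^ (-(k : ℝ))))
    (hE1 : ∀ k : ℤ, k_E ≤ k → env₀ k ≤ K₀ * r ^ 2 / w (k - 1) ^ 2)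
    (hexist : ∀ S₀ : Fin m → ℤ → ℝ, ballDesc Z w r S₀ (fun i k => (1 / 2) * S₀ i k ^ 2) →
      ∃ S F : Fin m → ℤ → ℝ → ℝ,
        PseudoFlowOn c ε₀ α 0 0 S₀ (fun i k => (1 / 2) * S₀ i k ^ 2) (fun _ _ => 0) S F)
    (hstep : StepSlack σ ε₀ i₀ α Z w r ρ θ₀ c₀ env₀) :
    GapData₂ σ ε₀ i₀ α X₀ Z w r ρ θ₀ θ c₀ c env₀ ∧ TailThin ε₀ w r := by
  have hw1 : ∀ k, 1 ≤ w k := htcCF_one_le_weight hC (by linarith) w hwA hwB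
  have htc : TailCompat ε₀ Z w r env₀ :=
    htcCF_tailCompat hε hε1 hr.le hC hb w hwA Z env₀ hZ2 hE1
  have hgap : GapData ε₀ i₀ α X₀ Z w r ρ θ₀ θ c₀ c env₀ :=
    ⟨hr, hρ, hρ1, hθ₀, hθ, hθ1, hc₀, hc, hw1, hZ1, htc.tailFat, hexist,
      fun S₀ τ S F hball hτ hflow => hstep.step S₀ τ S F hball hτ hflow⟩
  exact ⟨⟨hgap, hσ, htcCF_tameBehind hε hC w hwA hwB Z hZ3, hstep, htc⟩,
    htcCF_weight_tailThin hε hε1 hr.le (by linarith) w hwA⟩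

end Summit.NavierStokesRegularity.NavierStokesRegularity.Theorems

end
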